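import Mathlib
import Summits.Ventures.HodgeRepro.OcticCMPointGaloisRingPrimitive

/-!
# OcticCMPointGaloisRingUnits — the units of `GR(4, 4)`: `u = r^k (1 + 2a)`

Blind re-derivation cell `pub-hodge-repro`, seat night-2 (gen 4, final cycle).  Target tree path
`lean/Summits/Ventures/HodgeRepro/OcticCMPointGaloisRingUnits.lean`.  Fourth step of the conductor-`2` line at the
inert place `𝔮 | 2`: **every unit of `GR(4, 4)` is `r^k (1 + 2a)`** with `r` the Teichmüller generator (`r¹⁵ = 1`)
and `a ∈ GR(4, 4)` (`exists_teichmuller_mul_of_isUnit`), and conversely (`isUnit_teichmuller_mul`); the decomposition is unique — `k` is determined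
(`teichmuller_exponent_unique`) and `a` is determined mod `2GR` (`wild_part_unique`) — so the units are parametrised
by `ℤ/15 × (ℤ/2)⁴` (`240` of them; the group isomorphism itself is not packaged here).

The argument is computational: the residues mod `2GR` of the `15` powers `r^k` (`k < 15`) are the `15` non-zero vectors
of `(ℤ/2)⁴` in the power basis (`red2_r_pow`, the table `teich2`; the coordinates of every `r^k` are `linear_combination`
identities), an element with residue `0` is `2b` and hence nilpotent — not a unit (`red2_ne_zero_of_isUnit`) — so a unit
`u` has the residue of some `r^k`, `u − r^k = 2b`, and `u = r^k (1 + 2 r^{15−k} b)`.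

**What this is not.**  The conductor-`2` characters and their Gauss sums are NOT here (the last step, LIMITS-next-g4.md
§B.4).  Nothing here says anything about the status of the Hodge conjecture for CM abelian varieties, which is NOT
proved.
-/

set_option autoImplicit false

noncomputable section

open Polynomial

namespace Summit.Ventures.HodgeRepro.PeriodCloser

namespace GaloisRing

/-! ### Coordinates of explicit combinations, and the residue map mod `2GR` -/

/-- `r ^ (i : ℕ) = b4 i` for `i : Fin 4`. -/
theorem r_pow_eq_b4 (i : Fin 4) : r ^ (i : ℕ) = b4 i := (b4_apply i).symm

/-- The coordinates of `c₀ • 1 + c₁ • r + c₂ • r² + c₃ • r³` in `b4`. -/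
theorem coords_comb (c₀ c₁ c₂ c₃ : ZMod 4) (i : Fin 4) :
    b4.repr (c₀ • (1 : GR44) + c₁ • r + c₂ • r ^ 2 + c₃ • r ^ 3) i = ![c₀, c₁, c₂, c₃] i := by
  have h0 : (1 : GR44) = b4 0 := by rw [← r_pow_eq_b4]; simp
  have h1 : r = b4 1 := by rw [← r_pow_eq_b4]; simp
  have h2 : r ^ 2 = b4 2 := by rw [← r_pow_eq_b4]; rfl
  have h3 : r ^ 3 = b4 3 := by rw [← r_pow_eq_b4]; rfl
  rw [h3, h2, h1, h0, map_add, map_add, map_add, map_smul, map_smul, map_smul, map_smul,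
    Module.Basis.repr_self, Module.Basis.repr_self, Module.Basis.repr_self, Module.Basis.repr_self]
  simp only [Finsupp.coe_add, Finsupp.coe_smul, Pi.add_apply, Pi.smul_apply, Finsupp.single_apply, smul_eq_mul]
  fin_cases i <;> simp

/-- The reduction `ℤ/4 → ℤ/2`. -/
def c2 : ZMod 4 →+* ZMod 2 := ZMod.castHom (by norm_num : 2 ∣ 4) (ZMod 2)

/-- **The residue of `y` mod `2GR`**, as a vector in `(ℤ/2)⁴` (the coordinates mod `2`). -/
def red2 (y : GR44) : Fin 4 → ZMod 2 := fun i => c2 (b4.repr y i)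

/-- `red2` is additive. -/
theorem red2_add (y z : GR44) : red2 (y + z) = red2 y + red2 z := by
  funext i; simp [red2, map_add]

/-- `red2 (−y) = −red2 y`. -/
theorem red2_neg (y : GR44) : red2 (-y) = -red2 y := by
  funext i; simp [red2, map_neg]

/-- `red2 (2 • b) = 0`. -/
theorem red2_two_mul (b : GR44) : red2 (2 * b) = 0 := by
  funext i
  have : (2 : GR44) * b = (2 : ZMod 4) • b := by rw [Algebra.smul_def, map_ofNat]
  simp only [red2, this, map_smul, Finsupp.coe_smul, Pi.smul_apply, smul_eq_mul, map_mul, Pi.zero_apply]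
  have h2 : c2 2 = 0 := by decide
  rw [h2, zero_mul]

/-- **The residues of the `15` Teichmüller powers** `r^k`, `k < 15`. -/
def teich2 : Fin 15 → Fin 4 → ZMod 2 :=
  ![![1,0,0,0],![0,1,0,0],![0,0,1,0],![0,0,0,1],![1,1,0,0],![0,1,1,0],![0,0,1,1],![1,1,0,1],![1,0,1,0],![0,1,0,1],![1,1,1,0],![0,1,1,1],![1,1,1,1],![1,0,1,1],![1,0,0,1]]

/-- Every `r ^ k` for `k < 15` has the tabulated residue (the coordinates of `r^k` are explicit
`linear_combination`s of the relation and `4 = 0`; `numerics/gr44_units_witnesses.out`). -/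
theorem red2_r_pow (k : Fin 15) : red2 (r ^ (k : ℕ)) = teich2 k := by
  have hrel := r_rel
  have h4 := four_eq_zero
  have h2 : algebraMap (ZMod 4) GR44 2 = 2 := map_ofNat _ _
  have h3 : algebraMap (ZMod 4) GR44 3 = 3 := map_ofNat _ _
  unfold red2
  fin_cases k
  · rw [show r ^ 0 = (1 : ZMod 4) • (1 : GR44) + (0 : ZMod 4) • r + (0 : ZMod 4) • r ^ 2 + (0 : ZMod 4) • r ^ 3 by
      simp only [smul_eq_num, map_zero, map_one]; ring]
    funext i; rw [coords_comb]; fin_cases i <;> rfl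
  · rw [show r ^ 1 = (0 : ZMod 4) • (1 : GR44) + (1 : ZMod 4) • r + (0 : ZMod 4) • r ^ 2 + (0 : ZMod 4) • r ^ 3 by
      simp only [smul_eq_num, map_zero, map_one]; ring]
    funext i; rw [coords_comb]; fin_cases i <;> rfl
  · rw [show r ^ 2 = (0 : ZMod 4) • (1 : GR44) + (0 : ZMod 4) • r + (1 : ZMod 4) • r ^ 2 + (0 : ZMod 4) • r ^ 3 by
      simp only [smul_eq_num, map_zero, map_one]; ring]
    funext i; rw [coords_comb]; fin_cases i <;> rfl
  · rw [show r ^ 3 = (0 : ZMod 4) • (1 : GR44) + (0 : ZMod 4) • r + (0 : ZMod 4) • r ^ 2 + (1 : ZMod 4) • r ^ 3 by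
      simp only [smul_eq_num, map_zero, map_one]; ring]
    funext i; rw [coords_comb]; fin_cases i <;> rfl
  · rw [show r ^ 4 = (3 : ZMod 4) • (1 : GR44) + (1 : ZMod 4) • r + (2 : ZMod 4) • r ^ 2 + (0 : ZMod 4) • r ^ 3 by
      simp only [smul_eq_num, map_zero, map_one, h2, h3]; linear_combination ((1 : GR44)) * hrel + ((-1 : GR44) + (-1 : GR44) * r + (-1 : GR44) * r ^ 2) * h4]
    funext i; rw [coords_comb]; fin_cases i <;> rfl
  · rw [show r ^ 5 = (0 : ZMod 4) • (1 : GR44) + (3 : ZMod 4) • r + (1 : ZMod 4) • r ^ 2 + (2 : ZMod 4) • r ^ 3 by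
      simp only [smul_eq_num, map_zero, map_one, h2, h3]; linear_combination ((1 : GR44) * r) * hrel + ((-1 : GR44) * r + (-1 : GR44) * r ^ 2 + (-1 : GR44) * r ^ 3) * h4]
    funext i; rw [coords_comb]; fin_cases i <;> rfl
  · rw [show r ^ 6 = (2 : ZMod 4) • (1 : GR44) + (2 : ZMod 4) • r + (3 : ZMod 4) • r ^ 2 + (1 : ZMod 4) • r ^ 3 by
      simp only [smul_eq_num, map_one, h2, h3]; linear_combination ((-2 : GR44) + (1 : GR44) * r ^ 2) * hrel + ((1 : GR44) * r + (-1 : GR44) * r ^ 3) * h4]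
    funext i; rw [coords_comb]; fin_cases i <;> rfl
  · rw [show r ^ 7 = (3 : ZMod 4) • (1 : GR44) + (3 : ZMod 4) • r + (0 : ZMod 4) • r ^ 2 + (3 : ZMod 4) • r ^ 3 by
      simp only [smul_eq_num, map_zero, h3]; linear_combination ((-3 : GR44) + (-2 : GR44) * r + (1 : GR44) * r ^ 3) * hrel + ((2 : GR44) * r + (3 : GR44) * r ^ 2) * h4]
    funext i; rw [coords_comb]; fin_cases i <;> rfl
  · rw [show r ^ 8 = (1 : ZMod 4) • (1 : GR44) + (2 : ZMod 4) • r + (1 : ZMod 4) • r ^ 2 + (0 : ZMod 4) • r ^ 3 by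
      simp only [smul_eq_num, map_zero, map_one, h2]; linear_combination ((3 : GR44) + (-3 : GR44) * r + (-2 : GR44) * r ^ 2 + (1 : GR44) * r ^ 4) * hrel + ((-1 : GR44) + (-2 : GR44) * r + (1 : GR44) * r ^ 2 + (3 : GR44) * r ^ 3) * h4]
    funext i; rw [coords_comb]; fin_cases i <;> rfl
  · rw [show r ^ 9 = (0 : ZMod 4) • (1 : GR44) + (1 : ZMod 4) • r + (2 : ZMod 4) • r ^ 2 + (1 : ZMod 4) • r ^ 3 by
      simp only [smul_eq_num, map_zero, map_one, h2]; linear_combination ((12 : GR44) + (3 : GR44) * r + (-3 : GR44) * r ^ 2 + (-2 : GR44) * r ^ 3 + (1 : GR44) * r ^ 5) * hrel + ((-3 : GR44) + (-10 : GR44) * r + (-8 : GR44) * r ^ 2 + (1 : GR44) * r ^ 3) * h4]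
    funext i; rw [coords_comb]; fin_cases i <;> rfl
  · rw [show r ^ 10 = (3 : ZMod 4) • (1 : GR44) + (1 : ZMod 4) • r + (3 : ZMod 4) • r ^ 2 + (2 : ZMod 4) • r ^ 3 by
      simp only [smul_eq_num, map_one, h2, h3]; linear_combination ((5 : GR44) + (12 : GR44) * r + (3 : GR44) * r ^ 2 + (-3 : GR44) * r ^ 3 + (-2 : GR44) * r ^ 4 + (1 : GR44) * r ^ 6) * hrel + ((-2 : GR44) + (-7 : GR44) * r + (-13 : GR44) * r ^ 2 + (-8 : GR44) * r ^ 3) * h4]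
    funext i; rw [coords_comb]; fin_cases i <;> rfl
  · rw [show r ^ 11 = (2 : ZMod 4) • (1 : GR44) + (1 : ZMod 4) • r + (1 : ZMod 4) • r ^ 2 + (3 : ZMod 4) • r ^ 3 by
      simp only [smul_eq_num, map_one, h2, h3]; linear_combination ((-30 : GR44) + (5 : GR44) * r + (12 : GR44) * r ^ 2 + (3 : GR44) * r ^ 3 + (-3 : GR44) * r ^ 4 + (-2 : GR44) * r ^ 5 + (1 : GR44) * r ^ 7) * hrel + ((7 : GR44) + (21 : GR44) * r + (8 : GR44) * r ^ 2 + (-13 : GR44) * r ^ 3) * h4]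
    funext i; rw [coords_comb]; fin_cases i <;> rfl
  · rw [show r ^ 12 = (1 : ZMod 4) • (1 : GR44) + (1 : ZMod 4) • r + (3 : ZMod 4) • r ^ 2 + (1 : ZMod 4) • r ^ 3 by
      simp only [smul_eq_num, map_one, h3]; linear_combination ((-49 : GR44) + (-30 : GR44) * r + (5 : GR44) * r ^ 2 + (12 : GR44) * r ^ 3 + (3 : GR44) * r ^ 4 + (-3 : GR44) * r ^ 5 + (-2 : GR44) * r ^ 6 + (1 : GR44) * r ^ 8) * hrel + ((12 : GR44) + (44 : GR44) * r + (45 : GR44) * r ^ 2 + (8 : GR44) * r ^ 3) * h4]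
    funext i; rw [coords_comb]; fin_cases i <;> rfl
  · rw [show r ^ 13 = (3 : ZMod 4) • (1 : GR44) + (2 : ZMod 4) • r + (3 : ZMod 4) • r ^ 2 + (3 : ZMod 4) • r ^ 3 by
      simp only [smul_eq_num, h2, h3]; linear_combination ((33 : GR44) + (-49 : GR44) * r + (-30 : GR44) * r ^ 2 + (5 : GR44) * r ^ 3 + (12 : GR44) * r ^ 4 + (3 : GR44) * r ^ 5 + (-3 : GR44) * r ^ 6 + (-2 : GR44) * r ^ 7 + (1 : GR44) * r ^ 9) * hrel + ((-9 : GR44) + (-13 : GR44) * r + (27 : GR44) * r ^ 2 + (45 : GR44) * r ^ 3) * h4]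
    funext i; rw [coords_comb]; fin_cases i <;> rfl
  · rw [show r ^ 14 = (1 : ZMod 4) • (1 : GR44) + (2 : ZMod 4) • r + (0 : ZMod 4) • r ^ 2 + (3 : ZMod 4) • r ^ 3 by
      simp only [smul_eq_num, map_zero, map_one, h2, h3]; linear_combination ((183 : GR44) + (33 : GR44) * r + (-49 : GR44) * r ^ 2 + (-30 : GR44) * r ^ 3 + (5 : GR44) * r ^ 4 + (12 : GR44) * r ^ 5 + (3 : GR44) * r ^ 6 + (-3 : GR44) * r ^ 7 + (-2 : GR44) * r ^ 8 + (1 : GR44) * r ^ 10) * hrel + ((-46 : GR44) + (-146 : GR44) * r + (-104 : GR44) * r ^ 2 + (27 : GR44) * r ^ 3) * h4]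
    funext i; rw [coords_comb]; fin_cases i <;> rfl

/-- The `15` tabulated residues are exactly the non-zero vectors of `(ℤ/2)⁴`. -/
theorem teich2_surj (v : Fin 4 → ZMod 2) (hv : v ≠ 0) : ∃ k : Fin 15, teich2 k = v := by
  revert v
  decide

/-! ### Elements of residue `0` are `2b`, hence nilpotent -/

/-- `c2 c = 0 → c = 2 d`. -/
theorem eq_two_mul_of_c2_eq_zero (c : ZMod 4) (h : c2 c = 0) : ∃ d : ZMod 4, c = 2 * d := by
  revert c; decide

/-- **Residue `0` means `y = 2b`.** -/
theorem eq_two_mul_of_red2_eq_zero {y : GR44} (h : red2 y = 0) : ∃ b : GR44, y = 2 * b := by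
  classical
  choose d hd using fun i => eq_two_mul_of_c2_eq_zero (b4.repr y i) (congrFun h i)
  refine ⟨∑ i, d i • b4 i, ?_⟩
  conv_lhs => rw [← b4.sum_repr y]
  rw [Finset.mul_sum]
  refine Finset.sum_congr rfl fun i _ => ?_
  rw [hd i, show (2 : GR44) * (d i • b4 i) = ((2 : ZMod 4) * d i) • b4 i by
    rw [mul_smul, Algebra.smul_def (2 : ZMod 4), map_ofNat]]

/-- A unit has non-zero residue: `u = 2b` would give `u² = 0`, but `u² v² = 1`. -/
theorem red2_ne_zero_of_isUnit {u : GR44} (hu : IsUnit u) : red2 u ≠ 0 := by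
  intro h
  obtain ⟨b, rfl⟩ := eq_two_mul_of_red2_eq_zero h
  obtain ⟨v, hv⟩ := hu.exists_right_inv
  have h4 := four_eq_zero
  have hsq : (2 * b) ^ 2 = 0 := by linear_combination (b ^ 2) * h4
  have : (1 : GR44) = 0 := by
    calc (1 : GR44) = ((2 * b) * v) ^ 2 := by rw [hv, one_pow]
      _ = (2 * b) ^ 2 * v ^ 2 := by ring
      _ = 0 := by rw [hsq, zero_mul]
  exact zero_ne_one_GR44 this.symm

/-! ### The decomposition `u = r^k (1 + 2a)` -/

/-- **Every unit of `GR(4, 4)` is `r^k (1 + 2a)`** for some `k < 15` and `a ∈ GR(4, 4)`. -/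
theorem exists_teichmuller_mul_of_isUnit {u : GR44} (hu : IsUnit u) :
    ∃ (k : Fin 15) (a : GR44), u = r ^ (k : ℕ) * (1 + 2 * a) := by
  obtain ⟨k, hk⟩ := teich2_surj (red2 u) (red2_ne_zero_of_isUnit hu)
  have hres : red2 (u - r ^ (k : ℕ)) = 0 := by
    rw [sub_eq_add_neg, red2_add, red2_neg, red2_r_pow, hk, add_neg_cancel]
  obtain ⟨b, hb⟩ := eq_two_mul_of_red2_eq_zero hres
  refine ⟨k, r ^ (15 - (k : ℕ)) * b, ?_⟩
  have h15 : r ^ (k : ℕ) * r ^ (15 - (k : ℕ)) = 1 := by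
    rw [← pow_add, Nat.add_sub_cancel' (by omega : (k : ℕ) ≤ 15), r_pow_fifteen]
  calc u = r ^ (k : ℕ) + 2 * b := by rw [← hb]; ring
    _ = r ^ (k : ℕ) * (1 + 2 * (r ^ (15 - (k : ℕ)) * b)) := by
      linear_combination (-2 * b) * h15

/-- Conversely `r^k (1 + 2a)` is a unit: `r¹⁵ = 1` and `(1 + 2a)(1 − 2a) = 1`. -/
theorem isUnit_teichmuller_mul (k : ℕ) (a : GR44) : IsUnit (r ^ k * (1 + 2 * a)) := by
  have h4 := four_eq_zero
  have hr : IsUnit (r ^ k) := by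
    refine IsUnit.of_mul_eq_one (r ^ (15 * k - k)) ?_
    rw [← pow_add, show k + (15 * k - k) = 15 * k by omega, pow_mul, r_pow_fifteen, one_pow]
  have ha : IsUnit (1 + 2 * a) := by
    refine IsUnit.of_mul_eq_one (1 - 2 * a) ?_
    linear_combination (-(a ^ 2)) * h4
  exact hr.mul ha

/-! ### Uniqueness of the decomposition: `k` is determined, and `a` is determined mod `2GR` -/

/-- The table of residues is injective (the `15` Teichmüller residues are distinct). -/
theorem teich2_injective : Function.Injective teich2 := by
  intro a b h
  revert a b
  decide

/-- `red2 (r^k (1 + 2a)) = teich2 k`: the wild factor does not change the residue. -/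
theorem red2_teichmuller_mul (k : Fin 15) (a : GR44) : red2 (r ^ (k : ℕ) * (1 + 2 * a)) = teich2 k := by
  rw [show r ^ (k : ℕ) * (1 + 2 * a) = r ^ (k : ℕ) + 2 * (r ^ (k : ℕ) * a) by ring, red2_add, red2_two_mul,
    add_zero, red2_r_pow]

/-- **The Teichmüller exponent is unique**: `r^k (1 + 2a) = r^{k′} (1 + 2a′) → k = k′`. -/
theorem teichmuller_exponent_unique {k k' : Fin 15} {a a' : GR44}
    (h : r ^ (k : ℕ) * (1 + 2 * a) = r ^ (k' : ℕ) * (1 + 2 * a')) : k = k' := by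
  apply teich2_injective
  rw [← red2_teichmuller_mul k a, h, red2_teichmuller_mul]

/-- **The wild part is unique mod `2GR`**: `r^k (1 + 2a) = r^k (1 + 2a′) → 2a = 2a′`. -/
theorem wild_part_unique {k : Fin 15} {a a' : GR44}
    (h : r ^ (k : ℕ) * (1 + 2 * a) = r ^ (k : ℕ) * (1 + 2 * a')) : 2 * a = 2 * a' := by
  have hu : IsUnit (r ^ (k : ℕ)) := by
    have := isUnit_teichmuller_mul (k : ℕ) 0
    rwa [mul_zero, add_zero, mul_one] at this
  have := hu.mul_left_cancel h
  linear_combination this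

end GaloisRing

end Summit.Ventures.HodgeRepro.PeriodCloser

end
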